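import Literature.NumberTheory.Automorphic.ArchRankinSelbergTestVectorRankOne
import Literature.NumberTheory.Automorphic.ArchRankinSelbergOfTorusKirillov
import Literature.NumberTheory.Automorphic.ArchKirillovMellinConvergenceGL2
import HarnessLib

/-!
# Absolute convergence of the archimedean `GL₂ × GL₂` Rankin–Selberg integrals with a
# polynomial-times-Gaussian (the mirabolic reduction at `re s ≥ 1`)

Topic `NumberTheory/Automorphic`; namespace `Literature.NumberTheory.Automorphic`. Theorems only (no
definition, no named fact, no instance). Toolkit for clause (ii) of the named fact
`HumphriesJo2024_archRankinSelberg_testVector 2 K` (`ArchRankinSelbergTestVector`: integrability of the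
integrand of `Ψ_∞(s; W_e, W̄'_{e'}, Φ_∞)` for `K_∞`-finite Gårding `e, e'`, polynomial-times-Gaussian
`Φ_∞`, `re s > 1`; Jacquet–Shalika (1981), §3–§4; Cogdell (2004), §3.1 (1), §3.2), from the tree's
classification-free Kirillov theory of `GL₂(K_∞)`:

* §1 LINEAR Kirillov multipliers: the polynomial weights `Ψ_m(u) = ∏_w (1 + N_w(u)²)^m` are
  `W_{P v} = Ψ_m W_v` for an operator `P ∈ End(𝒢)` (the multipliers of
  `ArchKirillovMellinConvergenceGL2`, Jacquet–Langlands (1970), Lemma 5.13.1, re-run keeping the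
  operator), §2 `N(u)^ρ ≤ Ψ_m(u)²` (`ρ ≤ 2m`);
* §3 a linear operator on the Gårding space is bounded on the `K_∞`-orbit of a `K_∞`-finite vector of a
  unitary representation (finite-dimensional span), §4 hence the WEIGHTED torus Kirillov bound
  `∫ |W_{τ(k)e}(u)|² N(u)^ρ dμ ≤ B` uniformly in `k ∈ K_∞` (Jacquet–Shalika (1981), (3.16):
  `ArchKirillovBoundGL2.exists_lintegral_enorm_sq_kirillovFn_le`);
* §5 a polynomial-times-Gaussian is dominated by `C e^{-a‖c‖²}` at the last row `c · row₂(k)`,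
  uniformly on the compact `K_∞`; §6 the torus weight `|det y|^σ δ_B⁻¹ = N(c)^{2σ} N(u)^{σ-1}` in the
  coordinates `y = c · (u, 1)` and the Gaussian moment `∫ e^{-a‖c‖²} N(c)^r d^×c < ∞` (`r ≥ 2`);
* §7 `lintegral_whittaker_sq_polyGaussian_lt_top` (**main**): for `τ` irreducible unitary, `ℓ` a
  continuous Whittaker functional, `e` `K_∞`-finite Gårding, `Φ_∞` polynomial-times-Gaussian, `σ ≥ 1`
  and Haar measures `μA, μK`:
  `∫ |ℓ(τ(diag(y) k) e)|² |Φ_∞(e₂ diag(y) k)| |det y|^σ δ_B(y)⁻¹ d(μA × μK) < ∞` — the mirabolic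
  reduction of `ArchRankinSelbergOfTorusKirillov` (there: `σ = 1`, the fixed Gaussian, Sobolev
  control) adapted to `σ ≥ 1`, arbitrary polynomial-times-Gaussians and `K_∞`-finite vectors.

## References

* H. Jacquet, J. A. Shalika, *On Euler products and the classification of automorphic
  representations I*, Amer. J. Math. 103 (1981), §3 (3.16), §4 [JacquetShalikaAJM1981].
* H. Jacquet, R. P. Langlands, *Automorphic Forms on GL(2)*, LNM 114 (1970), §5 Lemma 5.13.1, §6
  [JacquetLanglands1970].
* J. W. Cogdell, *Analytic theory of L-functions for GL_n* (2004), §3.1 (1), §3.2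
  [CogdellAnalyticTheory2004].
* P. Humphries, Y. Jo, *Test vectors for archimedean period integrals*, Publ. Mat. 68 (2024),
  Thm. 1.1 [HumphriesJo2024].
-/

noncomputable section

open MeasureTheory Measure NumberField NumberField.mixedEmbedding NumberField.InfinitePlace IsDedekindDomain Set Filter
open scoped MatrixGroups ENNReal NNReal Classical ComplexConjugate

namespace Literature.NumberTheory.Automorphic

-- as in `ArchGardingWhittaker` / `ArchKirillovMellinConvergenceGL2`
set_option backward.isDefEq.respectTransparency false

variable {K : Type} [Field K] [NumberField K]

/-! ### 1. Linear Kirillov multipliers -/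

section Multipliers

variable {hcpt : isCompact_glFiniteIntegralLevel 2 K}
  {E : Type*} [NormedAddCommGroup E] [NormedSpace ℂ E] [CompleteSpace E]
  {τ : ContRepresentation ℂ (AutomorphyDatum.gl 2 K hcpt).arch.carrier E}
  (hτ : τ.IsStronglyContinuous) {ℓ : archGardingSpace hcpt τ →ₗ[ℂ] ℂ}

/-- **`1 + u_w²` is a LINEAR Kirillov multiplier** at a real place: `(1 + u_w²) W_v = W_{P v}` with
`P = 1 - (4π²)⁻¹ τ(E₀₁ ⊗ r_w)² ∈ End(𝒢)`. [cite: JacquetLanglands1970, §5 (Lemma 5.13.1)] -/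
theorem exists_linMult_real (hℓW : IsArchContWhittakerFunctional hcpt τ hτ ℓ)
    (w : {w : InfinitePlace K // IsReal w}) :
    ∃ P : Module.End ℂ (archGardingSpace hcpt τ), ∀ (v : archGardingSpace hcpt τ) (u : (mixedSpace K)ˣ),
      kirillovFn hτ ℓ (P v) u = ((1 + ((u : mixedSpace K).1 w) ^ 2 : ℝ) : ℂ) * kirillovFn hτ ℓ v u := by
  refine ⟨1 - (((4 * Real.pi ^ 2)⁻¹ : ℝ) : ℂ) •
    (gardingEnd hτ (Matrix.single 0 1 ((Pi.single w 1, 0) : mixedSpace K)) *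
      gardingEnd hτ (Matrix.single 0 1 ((Pi.single w 1, 0) : mixedSpace K))), fun v u => ?_⟩
  change kirillovFn hτ ℓ (v - (((4 * Real.pi ^ 2)⁻¹ : ℝ) : ℂ) •
    gardingEnd hτ (Matrix.single 0 1 ((Pi.single w 1, 0) : mixedSpace K))
      (gardingEnd hτ (Matrix.single 0 1 ((Pi.single w 1, 0) : mixedSpace K)) v)) u = _
  rw [kirillovFn_sub_smul, kirillovFn_gardingEnd_realIdem hτ hℓW, kirillovFn_gardingEnd_realIdem hτ hℓW]
  have hπ : (Real.pi : ℂ) ≠ 0 := by exact_mod_cast Real.pi_ne_zero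
  push_cast
  field_simp
  linear_combination (-4) * ((u : mixedSpace K).1 w : ℂ) ^ 2 * kirillovFn hτ ℓ v u * Complex.I_sq

/-- **`1 + |z_w|²` is a LINEAR Kirillov multiplier** at a complex place:
`(1 + |z_w|²) W_v = W_{P v}`, `P = 1 - (16π²)⁻¹ (τ(E₀₁ ⊗ c_w)² + τ(E₀₁ ⊗ ic_w)²)`. [cite: JacquetLanglands1970, §6] -/
theorem exists_linMult_complex (hℓW : IsArchContWhittakerFunctional hcpt τ hτ ℓ)
    (w : {w : InfinitePlace K // IsComplex w}) :
    ∃ P : Module.End ℂ (archGardingSpace hcpt τ), ∀ (v : archGardingSpace hcpt τ) (u : (mixedSpace K)ˣ),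
      kirillovFn hτ ℓ (P v) u = ((1 + ‖(u : mixedSpace K).2 w‖ ^ 2 : ℝ) : ℂ) * kirillovFn hτ ℓ v u := by
  refine ⟨1 - (((16 * Real.pi ^ 2)⁻¹ : ℝ) : ℂ) •
      (gardingEnd hτ (Matrix.single 0 1 ((0, Pi.single w 1) : mixedSpace K)) *
        gardingEnd hτ (Matrix.single 0 1 ((0, Pi.single w 1) : mixedSpace K))) -
    (((16 * Real.pi ^ 2)⁻¹ : ℝ) : ℂ) •
      (gardingEnd hτ (Matrix.single 0 1 ((0, Pi.single w Complex.I) : mixedSpace K)) *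
        gardingEnd hτ (Matrix.single 0 1 ((0, Pi.single w Complex.I) : mixedSpace K))), fun v u => ?_⟩
  change kirillovFn hτ ℓ (v - (((16 * Real.pi ^ 2)⁻¹ : ℝ) : ℂ) •
      gardingEnd hτ (Matrix.single 0 1 ((0, Pi.single w 1) : mixedSpace K))
        (gardingEnd hτ (Matrix.single 0 1 ((0, Pi.single w 1) : mixedSpace K)) v) -
    (((16 * Real.pi ^ 2)⁻¹ : ℝ) : ℂ) •
      gardingEnd hτ (Matrix.single 0 1 ((0, Pi.single w Complex.I) : mixedSpace K))
        (gardingEnd hτ (Matrix.single 0 1 ((0, Pi.single w Complex.I) : mixedSpace K)) v)) u = _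
  rw [kirillovFn_sub_smul, kirillovFn_sub_smul, kirillovFn_gardingEnd_complexIdem hτ hℓW,
    kirillovFn_gardingEnd_complexIdem hτ hℓW, kirillovFn_gardingEnd_complexIdemI hτ hℓW,
    kirillovFn_gardingEnd_complexIdemI hτ hℓW, Complex.sq_norm, Complex.normSq_apply]
  have hπ : (Real.pi : ℂ) ≠ 0 := by exact_mod_cast Real.pi_ne_zero
  push_cast
  field_simp
  linear_combination (-16) * ((((u : mixedSpace K).2 w).re : ℂ) ^ 2 + ((((u : mixedSpace K).2 w).im : ℂ)) ^ 2) *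
    kirillovFn hτ ℓ v u * Complex.I_sq

/-- `1 + N_w(u)²` (`N_w` the norm at the place `w`) is a linear Kirillov multiplier, for every
archimedean place `w`. [cite: JacquetLanglands1970, §5 (Lemma 5.13.1), §6] -/
theorem exists_linMult_place (hℓW : IsArchContWhittakerFunctional hcpt τ hτ ℓ) (w : InfinitePlace K) :
    ∃ P : Module.End ℂ (archGardingSpace hcpt τ), ∀ (v : archGardingSpace hcpt τ) (u : (mixedSpace K)ˣ),
      kirillovFn hτ ℓ (P v) u = ((1 + normAtPlace w (u : mixedSpace K) ^ 2 : ℝ) : ℂ) * kirillovFn hτ ℓ v u := by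
  by_cases hw : IsReal w
  · obtain ⟨P, hP⟩ := exists_linMult_real hτ hℓW ⟨w, hw⟩
    refine ⟨P, fun v u => ?_⟩
    rw [hP, normAtPlace_apply_of_isReal hw, Real.norm_eq_abs, sq_abs]
  · have hw' : IsComplex w := not_isReal_iff_isComplex.mp hw
    obtain ⟨P, hP⟩ := exists_linMult_complex hτ hℓW ⟨w, hw'⟩
    refine ⟨P, fun v u => ?_⟩
    rw [hP, normAtPlace_apply_of_isComplex hw']

/-- Linear Kirillov multipliers are closed under finite products (composition of the operators). [folklore] -/
theorem exists_linMult_prod {ι : Type*} (s : Finset ι) {φ : ι → (mixedSpace K)ˣ → ℂ}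
    (hφ : ∀ i ∈ s, ∃ P : Module.End ℂ (archGardingSpace hcpt τ), ∀ (v : archGardingSpace hcpt τ) (u : (mixedSpace K)ˣ),
      kirillovFn hτ ℓ (P v) u = φ i u * kirillovFn hτ ℓ v u) :
    ∃ P : Module.End ℂ (archGardingSpace hcpt τ), ∀ (v : archGardingSpace hcpt τ) (u : (mixedSpace K)ˣ),
      kirillovFn hτ ℓ (P v) u = (∏ i ∈ s, φ i u) * kirillovFn hτ ℓ v u := by
  classical
  induction s using Finset.induction_on with
  | empty => exact ⟨1, fun v u => by rw [Module.End.one_apply, Finset.prod_empty, one_mul]⟩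
  | @insert j s hj ih =>
    obtain ⟨P, hP⟩ := ih (fun i hi => hφ i (Finset.mem_insert_of_mem hi))
    obtain ⟨Q, hQ⟩ := hφ j (Finset.mem_insert_self j s)
    exact ⟨Q * P, fun v u => by rw [Module.End.mul_apply, hQ, hP, Finset.prod_insert hj, mul_assoc]⟩

/-- Linear Kirillov multipliers are closed under powers. [folklore] -/
theorem exists_linMult_pow {φ : (mixedSpace K)ˣ → ℂ}
    (hφ : ∃ P : Module.End ℂ (archGardingSpace hcpt τ), ∀ (v : archGardingSpace hcpt τ) (u : (mixedSpace K)ˣ),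
      kirillovFn hτ ℓ (P v) u = φ u * kirillovFn hτ ℓ v u) (m : ℕ) :
    ∃ P : Module.End ℂ (archGardingSpace hcpt τ), ∀ (v : archGardingSpace hcpt τ) (u : (mixedSpace K)ˣ),
      kirillovFn hτ ℓ (P v) u = φ u ^ m * kirillovFn hτ ℓ v u := by
  induction m with
  | zero => exact ⟨1, fun v u => by rw [Module.End.one_apply, pow_zero, one_mul]⟩
  | succ m ih =>
    obtain ⟨P, hP⟩ := ih
    obtain ⟨Q, hQ⟩ := hφ
    exact ⟨Q * P, fun v u => by rw [Module.End.mul_apply, hQ, hP, pow_succ]; ring⟩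

/-- **The polynomial weights `Ψ_m(u) = ∏_w (1 + N_w(u)²)^m` are LINEAR Kirillov multipliers**:
there is `P ∈ End(𝒢)` with `W_{P v} = Ψ_m W_v` for every Gårding `v`. [cite: JacquetLanglands1970, §5 (Lemma 5.13.1), §6] -/
theorem exists_linMult_weight (hℓW : IsArchContWhittakerFunctional hcpt τ hτ ℓ) (m : ℕ) :
    ∃ P : Module.End ℂ (archGardingSpace hcpt τ), ∀ (v : archGardingSpace hcpt τ) (u : (mixedSpace K)ˣ),
      kirillovFn hτ ℓ (P v) u =
        (((∏ w : InfinitePlace K, (1 + normAtPlace w (u : mixedSpace K) ^ 2)) ^ m : ℝ) : ℂ) * kirillovFn hτ ℓ v u := by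
  have h1 : ∃ P : Module.End ℂ (archGardingSpace hcpt τ), ∀ (v : archGardingSpace hcpt τ) (u : (mixedSpace K)ˣ),
      kirillovFn hτ ℓ (P v) u =
        (∏ w : InfinitePlace K, (((1 + normAtPlace w (u : mixedSpace K) ^ 2 : ℝ)) : ℂ)) * kirillovFn hτ ℓ v u :=
    exists_linMult_prod hτ Finset.univ (fun w _ => exists_linMult_place hτ hℓW w)
  obtain ⟨P, hP⟩ := exists_linMult_pow hτ h1 m
  refine ⟨P, fun v u => ?_⟩
  rw [hP]
  push_cast
  rfl

end Multipliers

/-! ### 2. The weights dominate the norm -/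

section Weights

/-- `N(x) ≤ ∏_w (1 + N_w(x)²)` on `K_∞` (`N_w^{mult w} ≤ 1 + N_w²` termwise, `mult w ∈ {1, 2}`). [folklore] -/
theorem mixedEmbedding_norm_le_prod_one_add_sq (x : mixedSpace K) :
    mixedEmbedding.norm x ≤ ∏ w : InfinitePlace K, (1 + normAtPlace w x ^ 2) := by
  rw [mixedEmbedding.norm_apply]
  refine Finset.prod_le_prod (fun w _ => pow_nonneg (normAtPlace_nonneg _ _) _) fun w _ => ?_
  have h0 := normAtPlace_nonneg w x
  simp only [mult]
  split_ifs
  · rw [pow_one]; nlinarith [sq_nonneg (normAtPlace w x - 1)]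
  · nlinarith

/-- `1 ≤ ∏_w (1 + N_w(x)²)`. [folklore] -/
theorem one_le_prod_one_add_sq (x : mixedSpace K) : 1 ≤ ∏ w : InfinitePlace K, (1 + normAtPlace w x ^ 2) := by
  calc (1 : ℝ) = ∏ _w : InfinitePlace K, (1 : ℝ) := Finset.prod_const_one.symm
    _ ≤ _ := Finset.prod_le_prod (fun _ _ => zero_le_one) fun w _ => by nlinarith [sq_nonneg (normAtPlace w x)]

/-- `N(x)^ρ ≤ (Ψ_m(x))²` for `0 ≤ ρ ≤ 2m`, `Ψ_m = (∏_w (1 + N_w²))^m`. [folklore] -/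
theorem norm_rpow_le_weight_sq (x : mixedSpace K) {ρ : ℝ} (hρ : 0 ≤ ρ) {m : ℕ} (hm : ρ ≤ 2 * m) :
    mixedEmbedding.norm x ^ ρ ≤ ((∏ w : InfinitePlace K, (1 + normAtPlace w x ^ 2)) ^ m) ^ 2 := by
  have h1 : 1 ≤ ∏ w : InfinitePlace K, (1 + normAtPlace w x ^ 2) := one_le_prod_one_add_sq x
  calc mixedEmbedding.norm x ^ ρ ≤ (∏ w : InfinitePlace K, (1 + normAtPlace w x ^ 2)) ^ ρ :=
        Real.rpow_le_rpow (mixedEmbedding.norm_nonneg _) (mixedEmbedding_norm_le_prod_one_add_sq x) hρ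
    _ ≤ (∏ w : InfinitePlace K, (1 + normAtPlace w x ^ 2)) ^ ((2 * m : ℕ) : ℝ) :=
        Real.rpow_le_rpow_of_exponent_le h1 (by push_cast; linarith)
    _ = ((∏ w : InfinitePlace K, (1 + normAtPlace w x ^ 2)) ^ m) ^ 2 := by rw [Real.rpow_natCast, pow_mul']

end Weights

/-! ### 3. `K_∞`-finite vectors: a linear operator is bounded on the `K_∞`-orbit -/

section Orbit

variable {hcpt : isCompact_glFiniteIntegralLevel 2 K}
  {E : Type*} [NormedAddCommGroup E] [InnerProductSpace ℂ E] [CompleteSpace E]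
  {τ : ContRepresentation ℂ (AutomorphyDatum.gl 2 K hcpt).arch.carrier E}
  (hτ : τ.IsStronglyContinuous)

/-- **A linear operator on the Gårding space is bounded on the `K_∞`-orbit of a `K_∞`-finite vector**
of a unitary representation: the orbit `τ(k) e` lies in the finite-dimensional span `V` of the orbit,
on which `P` is continuous, and `‖τ(k) e‖ = ‖e‖`. [folklore] -/
theorem exists_norm_apply_orbit_le (hτu : τ.IsUnitary) (P : Module.End ℂ (archGardingSpace hcpt τ))
    (e : archGardingSpace hcpt τ)
    (he : FiniteDimensional ℂ (Submodule.span ℂ (Set.range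
      fun κ : (AutomorphyDatum.gl 2 K hcpt).arch.maximalCompact => τ (toArch hcpt (κ : GL (Fin 2) (mixedSpace K))) (e : E)))) :
    ∃ C : ℝ, 0 ≤ C ∧ ∀ k : ↥(Kinf 2 K),
      ‖((P ⟨τ (toArch hcpt (k : GL (Fin 2) (mixedSpace K))) (e : E), apply_mem_archGardingSpace hτ _ e.2⟩ :
        archGardingSpace hcpt τ) : E)‖ ≤ C := by
  -- the orbit inside the Gårding space and its span
  set f : ↥((AutomorphyDatum.gl 2 K hcpt).arch.maximalCompact) → archGardingSpace hcpt τ := fun κ =>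
    ⟨τ (toArch hcpt (κ : GL (Fin 2) (mixedSpace K))) (e : E), apply_mem_archGardingSpace hτ _ e.2⟩ with hf
  set V : Submodule ℂ (archGardingSpace hcpt τ) := Submodule.span ℂ (Set.range f) with hV
  have hmap : V.map (archGardingSpace hcpt τ).subtype = Submodule.span ℂ (Set.range
      fun κ : (AutomorphyDatum.gl 2 K hcpt).arch.maximalCompact => τ (toArch hcpt (κ : GL (Fin 2) (mixedSpace K))) (e : E)) := by
    rw [hV, Submodule.map_span, ← Set.range_comp]
    rfl
  haveI : FiniteDimensional ℂ V := by
    have e1 := Submodule.equivMapOfInjective _ (archGardingSpace hcpt τ).injective_subtype V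
    rw [hmap] at e1
    exact LinearEquiv.finiteDimensional e1.symm
  -- the bounded operator `V → E`
  set Q : V →ₗ[ℂ] E := (archGardingSpace hcpt τ).subtype ∘ₗ P ∘ₗ V.subtype with hQ
  set Qc : V →L[ℂ] E := LinearMap.toContinuousLinearMap Q with hQc
  refine ⟨‖Qc‖ * ‖(e : E)‖, by positivity, fun k => ?_⟩
  have hk : (⟨τ (toArch hcpt (k : GL (Fin 2) (mixedSpace K))) (e : E), apply_mem_archGardingSpace hτ _ e.2⟩ :
      archGardingSpace hcpt τ) ∈ V :=
    Submodule.subset_span ⟨⟨(k : GL (Fin 2) (mixedSpace K)), k.2⟩, rfl⟩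
  have h := Qc.le_opNorm ⟨_, hk⟩
  have hnorm : ‖(⟨_, hk⟩ : V)‖ = ‖(e : E)‖ := by
    change ‖τ (toArch hcpt (k : GL (Fin 2) (mixedSpace K))) (e : E)‖ = ‖(e : E)‖
    exact hτu.norm_map _ _
  rw [hnorm] at h
  exact h

end Orbit

/-! ### 4. The weighted Kirillov bound, uniformly on the `K_∞`-orbit -/

section KirillovBound

variable {hcpt : isCompact_glFiniteIntegralLevel 2 K}
  {E : Type*} [NormedAddCommGroup E] [InnerProductSpace ℂ E] [CompleteSpace E]
  {τ : ContRepresentation ℂ (AutomorphyDatum.gl 2 K hcpt).arch.carrier E}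
  (hτ : τ.IsStronglyContinuous) {ℓ : archGardingSpace hcpt τ →ₗ[ℂ] ℂ}

/-- **Weighted torus Kirillov bound on a `K_∞`-orbit**: for `τ` irreducible unitary, `ℓ` a continuous
Whittaker functional, `e` a `K_∞`-finite Gårding vector, `ρ ≥ 0` and a Haar measure `μA'` on `(K_∞ˣ)¹`,
`∫ |W_{τ(k)e}(u)|² N(u)^ρ dμA'(u) ≤ B < ∞` uniformly in `k ∈ K_∞` (`N^ρ ≤ Ψ_m²`, `Ψ_m W_v = W_{P v}`,
`∫ |W_{P v}|² ≤ C ‖P v‖²` and `‖P τ(k) e‖ ≤ C'`). [cite: JacquetShalikaAJM1981, §3, (3.16)] -/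
theorem exists_weightedKirillov_orbit_bound [MeasurableSpace ((mixedSpace K)ˣ)] [BorelSpace ((mixedSpace K)ˣ)]
    (hτu : τ.IsUnitary) (hτi : τ.IsTopIrreducible) (hℓ : IsArchContWhittakerFunctional hcpt τ hτ ℓ)
    (e : archGardingSpace hcpt τ)
    (he : FiniteDimensional ℂ (Submodule.span ℂ (Set.range
      fun κ : (AutomorphyDatum.gl 2 K hcpt).arch.maximalCompact => τ (toArch hcpt (κ : GL (Fin 2) (mixedSpace K))) (e : E))))
    {ρ : ℝ} (hρ : 0 ≤ ρ) (μA' : Measure (Fin 1 → (mixedSpace K)ˣ)) [IsHaarMeasure μA'] :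
    ∃ B : ℝ≥0∞, B ≠ ⊤ ∧ ∀ k : ↥(Kinf 2 K),
      ∫⁻ y', ‖kirillovFn hτ ℓ ⟨τ (toArch hcpt (k : GL (Fin 2) (mixedSpace K))) (e : E),
          apply_mem_archGardingSpace hτ _ e.2⟩ (y' 0)‖ₑ ^ 2 *
        ENNReal.ofReal (mixedEmbedding.norm ((y' 0 : (mixedSpace K)ˣ) : mixedSpace K) ^ ρ) ∂μA' ≤ B := by
  classical
  haveI : BorelSpace (Fin 1 → (mixedSpace K)ˣ) := Pi.borelSpace
  obtain ⟨m, hm⟩ : ∃ m : ℕ, ρ ≤ 2 * m :=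
    ⟨⌈ρ⌉₊, (Nat.le_ceil ρ).trans (by linarith [(Nat.cast_nonneg ⌈ρ⌉₊ : (0 : ℝ) ≤ _)])⟩
  obtain ⟨P, hP⟩ := exists_linMult_weight hτ hℓ m
  obtain ⟨CP, hCP0, hCP⟩ := exists_norm_apply_orbit_le hτ hτu P e he
  set eU : (Fin 1 → (mixedSpace K)ˣ) ≃ᵐ (mixedSpace K)ˣ := MeasurableEquiv.funUnique (Fin 1) (mixedSpace K)ˣ with heU
  haveI hHaar : IsHaarMeasure (μA'.map eU) := by
    have hco : (⇑eU : (Fin 1 → (mixedSpace K)ˣ) → (mixedSpace K)ˣ) = ⇑(MulEquiv.funUnique (Fin 1) (mixedSpace K)ˣ) := rfl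
    rw [hco]
    exact MulEquiv.isHaarMeasure_map μA' _ (continuous_apply _) (continuous_pi fun _ => continuous_id)
  obtain ⟨C, hC, hbound⟩ := exists_lintegral_enorm_sq_kirillovFn_le (μA'.map eU) hℓ hτu hτi
  refine ⟨C * ENNReal.ofReal (CP ^ 2), ENNReal.mul_ne_top hC ENNReal.ofReal_ne_top, fun k => ?_⟩
  set v : archGardingSpace hcpt τ := ⟨τ (toArch hcpt (k : GL (Fin 2) (mixedSpace K))) (e : E),
    apply_mem_archGardingSpace hτ _ e.2⟩ with hv
  have hpt : ∀ y' : Fin 1 → (mixedSpace K)ˣ,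
      ‖kirillovFn hτ ℓ v (y' 0)‖ₑ ^ 2 * ENNReal.ofReal (mixedEmbedding.norm ((y' 0 : (mixedSpace K)ˣ) : mixedSpace K) ^ ρ) ≤
        ‖kirillovFn hτ ℓ (P v) (eU y')‖ₑ ^ 2 := by
    intro y'
    have heUy : eU y' = y' 0 := rfl
    rw [heUy, hP v (y' 0)]
    set Ψ : ℝ := (∏ w : InfinitePlace K, (1 + normAtPlace w ((y' 0 : (mixedSpace K)ˣ) : mixedSpace K) ^ 2)) ^ m with hΨ
    have hΨ0 : 0 ≤ Ψ := pow_nonneg (le_trans zero_le_one (one_le_prod_one_add_sq _)) _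
    have hΨe : ‖((Ψ : ℝ) : ℂ)‖ₑ ^ 2 = ENNReal.ofReal (Ψ ^ 2) := by
      rw [← ofReal_norm, Complex.norm_real, Real.norm_of_nonneg hΨ0, ENNReal.ofReal_pow hΨ0]
    rw [enorm_mul, mul_pow, hΨe, mul_comm]
    exact mul_le_mul' (ENNReal.ofReal_le_ofReal (norm_rpow_le_weight_sq _ hρ hm)) le_rfl
  calc ∫⁻ y', ‖kirillovFn hτ ℓ v (y' 0)‖ₑ ^ 2 *
          ENNReal.ofReal (mixedEmbedding.norm ((y' 0 : (mixedSpace K)ˣ) : mixedSpace K) ^ ρ) ∂μA'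
      ≤ ∫⁻ y', ‖kirillovFn hτ ℓ (P v) (eU y')‖ₑ ^ 2 ∂μA' := lintegral_mono hpt
    _ = ∫⁻ u, ‖kirillovFn hτ ℓ (P v) u‖ₑ ^ 2 ∂(μA'.map eU) :=
        (lintegral_map_equiv (fun u => ‖kirillovFn hτ ℓ (P v) u‖ₑ ^ 2) eU).symm
    _ ≤ C * ‖((P v : archGardingSpace hcpt τ) : E)‖ₑ ^ 2 := hbound (P v)
    _ ≤ C * ENNReal.ofReal (CP ^ 2) := by
        refine mul_le_mul' le_rfl ?_
        rw [← ofReal_norm, ← ENNReal.ofReal_pow (norm_nonneg _)]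
        exact ENNReal.ofReal_le_ofReal (pow_le_pow_left₀ (norm_nonneg _) (hCP k) 2)

end KirillovBound

/-! ### 5. Polynomial-times-Gaussians: Gaussian domination, uniformly on `K_∞` -/

section PolyGauss

open scoped Matrix.Norms.Operator

/-- **Gaussian bound for a polynomial times a Gaussian on `(K_∞)ⁿ`**:
`|q(L x) e^{-‖T x‖²}| ≤ C e^{-m ‖x‖²}` with `C ≥ 0`, `m > 0` (temperate growth of polynomials,
`‖x‖ ≤ ‖T⁻¹‖ ‖T x‖`, and `(1 + r)^k e^{-m r²/2} ≤ e^{k²/(2m)}`). [folklore] -/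
theorem exists_polyGaussian_gauss_bound {n N : ℕ} (L : Fin N → ((Fin n → mixedSpace K) →L[ℝ] ℝ))
    (q : MvPolynomial (Fin N) ℂ)
    (T : (Fin n → mixedSpace K) ≃L[ℝ] EuclideanSpace ℝ (Fin (Module.finrank ℝ (Fin n → mixedSpace K)))) :
    ∃ (C m : ℝ), 0 ≤ C ∧ 0 < m ∧ ∀ x : Fin n → mixedSpace K,
      ‖MvPolynomial.eval (fun i => ((L i x : ℝ) : ℂ)) q * ((Real.exp (-‖T x‖ ^ 2) : ℝ) : ℂ)‖ ≤
        C * Real.exp (-(m * ‖x‖ ^ 2)) := by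
  obtain ⟨k, C, hC0, hC⟩ := exists_norm_le_of_hasTemperateGrowth (hasTemperateGrowth_eval_clm L q)
  set A : ℝ := ‖(T.symm : EuclideanSpace ℝ (Fin (Module.finrank ℝ (Fin n → mixedSpace K))) →L[ℝ]
    (Fin n → mixedSpace K))‖ with hA
  have hAx : ∀ x, ‖x‖ ≤ A * ‖T x‖ := fun x => by
    have h := (T.symm : _ →L[ℝ] (Fin n → mixedSpace K)).le_opNorm (T x)
    rwa [ContinuousLinearEquiv.coe_coe, ContinuousLinearEquiv.symm_apply_apply] at h
  set m : ℝ := 1 / (A + 1) ^ 2 with hm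
  have hA0 : 0 ≤ A := norm_nonneg _
  have hmpos : 0 < m := by rw [hm]; positivity
  refine ⟨C * Real.exp ((k : ℝ) ^ 2 / (4 * (m / 2))), m / 2, by positivity, by positivity, fun x => ?_⟩
  rw [norm_mul, Complex.norm_real, Real.norm_eq_abs, abs_of_pos (Real.exp_pos _)]
  have h1 : ‖x‖ ≤ (A + 1) * ‖T x‖ := (hAx x).trans (by nlinarith [norm_nonneg (T x)])
  have h2 : ‖x‖ ^ 2 ≤ (A + 1) ^ 2 * ‖T x‖ ^ 2 := by
    rw [← mul_pow]; exact pow_le_pow_left₀ (norm_nonneg _) h1 2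
  have h3 : m * ‖x‖ ^ 2 ≤ ‖T x‖ ^ 2 := by
    rw [hm, one_div, inv_mul_le_iff₀ (by positivity)]
    exact h2
  have hexp : Real.exp (-‖T x‖ ^ 2) ≤ Real.exp (-(m / 2) * ‖x‖ ^ 2) * Real.exp (-(m / 2 * ‖x‖ ^ 2)) := by
    rw [← Real.exp_add]
    exact Real.exp_le_exp.mpr (by linarith)
  have hpoly := one_add_rpow_mul_exp_neg_mul_sq_le (P := (k : ℝ)) (m := m / 2) (Nat.cast_nonneg k)
    (by positivity) (norm_nonneg x)
  rw [Real.rpow_natCast] at hpoly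
  have hCx := hC x
  calc ‖MvPolynomial.eval (fun i => ((L i x : ℝ) : ℂ)) q‖ * Real.exp (-‖T x‖ ^ 2)
      ≤ (C * (1 + ‖x‖) ^ k) * (Real.exp (-(m / 2) * ‖x‖ ^ 2) * Real.exp (-(m / 2 * ‖x‖ ^ 2))) :=
        mul_le_mul hCx hexp (Real.exp_pos _).le (by positivity)
    _ = C * ((1 + ‖x‖) ^ k * Real.exp (-(m / 2) * ‖x‖ ^ 2)) * Real.exp (-(m / 2 * ‖x‖ ^ 2)) := by ring
    _ ≤ C * Real.exp ((k : ℝ) ^ 2 / (4 * (m / 2))) * Real.exp (-(m / 2 * ‖x‖ ^ 2)) := by gcongr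

variable (K) in
/-- **Uniform Gaussian domination of a polynomial-times-Gaussian at the last row**: for `Φ_∞` a
polynomial times a Gaussian on `(K_∞)²` there are `C ≥ 0`, `a > 0` with
`|Φ_∞(e₂ diag(y) k)| ≤ C exp(-a ‖y₂‖²)` for all `k ∈ K_∞`, `y ∈ (K_∞ˣ)²` (the last row of `diag(y) k` is
`y₂ · row₂(k)`, and `‖y₂‖ ≤ D ‖y₂ · row₂(k)‖` on the compact `K_∞`). [folklore] -/
theorem exists_polyGaussian_archLastRow_le (Φ : (Fin 2 → InfiniteAdeleRing K) → ℂ) (hΦ : IsArchPolyGaussian 2 K Φ) :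
    ∃ (C a : ℝ), 0 ≤ C ∧ 0 < a ∧ ∀ k : GL (Fin 2) (mixedSpace K), k ∈ Kinf 2 K → ∀ y : Fin 2 → (mixedSpace K)ˣ,
      ‖Φ (archLastRow 2 K (glDiagonal 2 (mixedSpace K) y * k))‖ ≤
        C * Real.exp (-(a * ‖((y (Fin.last 1) : (mixedSpace K)ˣ) : mixedSpace K)‖ ^ 2)) := by
  obtain ⟨N, L, q, T, hΦ⟩ := hΦ
  obtain ⟨C, m, hC, hm, hb⟩ := exists_polyGaussian_gauss_bound L q T
  -- entries of `k⁻¹` are bounded on the compact `K_∞`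
  have hKc : IsCompact ((Kinf 2 K : Subgroup (GL (Fin 2) (mixedSpace K))) : Set (GL (Fin 2) (mixedSpace K))) :=
    isCompact_Kinf_holds 2 K
  have hcont : Continuous fun k : GL (Fin 2) (mixedSpace K) =>
      ((k⁻¹ : GL (Fin 2) (mixedSpace K)) : Matrix (Fin 2) (Fin 2) (mixedSpace K)) := Units.continuous_coe_inv
  obtain ⟨B, hB⟩ := (hKc.image hcont).isBounded.exists_norm_le
  have hB0 : 0 ≤ B := (norm_nonneg _).trans (hB _ ⟨1, Subgroup.one_mem _, rfl⟩)
  set D : ℝ := Fintype.card (Fin 2) * B with hD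
  have hD0 : 0 ≤ D := by rw [hD]; positivity
  refine ⟨C, m / (D + 1) ^ 2, hC, by positivity, fun k hk y => ?_⟩
  set c : mixedSpace K := ((y (Fin.last 1) : (mixedSpace K)ˣ) : mixedSpace K) with hc
  set r : Fin 2 → mixedSpace K := fun j => c * (k : Matrix (Fin 2) (Fin 2) (mixedSpace K)) (Fin.last 1) j with hr
  have hΦr : Φ (archLastRow 2 K (glDiagonal 2 (mixedSpace K) y * k)) =
      MvPolynomial.eval (fun i => ((L i r : ℝ) : ℂ)) q * ((Real.exp (-‖T r‖ ^ 2) : ℝ) : ℂ) := by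
    rw [archLastRow_glDiagonal_mul (n := 1), hΦ]
    simp only [RingEquiv.apply_symm_apply]
    rfl
  -- `c e₂ = r k⁻¹`, so `‖c‖ ≤ D ‖r‖`
  have hsingle : Pi.single (Fin.last 1) c =
      Matrix.vecMul r ((k⁻¹ : GL (Fin 2) (mixedSpace K)) : Matrix (Fin 2) (Fin 2) (mixedSpace K)) := by
    have hr' : r = Matrix.vecMul (Pi.single (Fin.last 1) c) (k : Matrix (Fin 2) (Fin 2) (mixedSpace K)) := by
      rw [Matrix.single_vecMul]
      rfl
    rw [hr', Matrix.vecMul_vecMul, ← Units.val_mul, mul_inv_cancel, Units.val_one, Matrix.vecMul_one]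
  have hnc : ‖c‖ ≤ D * ‖r‖ := by
    have h := norm_vecMul_le_of_forall_norm_entry_le r
      ((k⁻¹ : GL (Fin 2) (mixedSpace K)) : Matrix (Fin 2) (Fin 2) (mixedSpace K)) hB0
      fun i j => (norm_entry_le_linfty_opNorm _ i j).trans (hB _ ⟨k, hk, rfl⟩)
    rw [← hsingle, Pi.norm_single] at h
    exact h
  have h1 : ‖c‖ ≤ (D + 1) * ‖r‖ := hnc.trans (by nlinarith [norm_nonneg r])
  have h2 : ‖c‖ ^ 2 ≤ (D + 1) ^ 2 * ‖r‖ ^ 2 := by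
    rw [← mul_pow]; exact pow_le_pow_left₀ (norm_nonneg _) h1 2
  have h3 : m / (D + 1) ^ 2 * ‖c‖ ^ 2 ≤ m * ‖r‖ ^ 2 := by
    rw [div_mul_eq_mul_div, div_le_iff₀ (by positivity)]
    calc m * ‖c‖ ^ 2 ≤ m * ((D + 1) ^ 2 * ‖r‖ ^ 2) := mul_le_mul_of_nonneg_left h2 hm.le
      _ = m * ‖r‖ ^ 2 * (D + 1) ^ 2 := by ring
  rw [hΦr]
  refine (hb r).trans ?_
  exact mul_le_mul_of_nonneg_left (Real.exp_le_exp.mpr (by linarith)) hC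

end PolyGauss

/-! ### 6. The torus weight in the coordinates `y = c · (u, 1)` and the Gaussian moment -/

section Coordinates

/-- `diag((u, 1)) = a(u) = diag(u, 1)` (`glDiagonal 2` of `Fin.snoc u 1` is `diagGL2 (u 0) 1`). [folklore] -/
theorem glDiagonal_snoc_one_eq_diagGL2 {R : Type*} [CommRing R] (y' : Fin 1 → Rˣ) :
    glDiagonal 2 R (Fin.snoc (α := fun _ => Rˣ) y' 1) = diagGL2 (y' 0) 1 := by
  rw [diagGL2]
  congr 1
  funext i
  refine Fin.lastCases ?_ (fun j => ?_) i
  · rw [Fin.snoc_last]; rfl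
  · rw [Fin.snoc_castSucc, Fin.fin_one_eq_zero j]; rfl

/-- **`|det y|^σ δ_B(y)⁻¹ = N(c)^{2σ} N(u)^{σ-1}` for `y = c · (u, 1) ∈ (K_∞ˣ)²`.** [folklore] -/
theorem archTorusWeight_two_snoc_mul (σ : ℝ) (y' : Fin 1 → (mixedSpace K)ˣ) (c : (mixedSpace K)ˣ) :
    archTorusWeight 2 K σ (fun i => Fin.snoc (α := fun _ => (mixedSpace K)ˣ) y' 1 i * c) =
      mixedEmbedding.norm (c : mixedSpace K) ^ (2 * σ) *
        mixedEmbedding.norm ((y' 0 : (mixedSpace K)ˣ) : mixedSpace K) ^ (σ - 1) := by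
  have hc0 : 0 < mixedEmbedding.norm (c : mixedSpace K) := mixedEmbedding_norm_units_pos c
  unfold archTorusWeight
  rw [Fin.prod_univ_castSucc, Fin.prod_univ_one]
  simp only [Fin.snoc_castSucc, Fin.snoc_last, one_mul, Fin.val_castSucc, Fin.val_last, Fin.val_zero,
    Units.val_mul, map_mul, Nat.cast_zero, Nat.cast_one, Nat.cast_ofNat, mul_zero, sub_zero]
  rw [Real.mul_rpow (mixedEmbedding.norm_nonneg _) (mixedEmbedding.norm_nonneg _)]
  have e1 : σ - ((2 : ℝ) - 1) = σ - 1 := by ring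
  have e2 : σ - ((2 : ℝ) - 1 - 2 * 1) = σ + 1 := by ring
  have hsplit : mixedEmbedding.norm (c : mixedSpace K) ^ (2 * σ) =
      mixedEmbedding.norm (c : mixedSpace K) ^ (σ - 1) * mixedEmbedding.norm (c : mixedSpace K) ^ (σ + 1) := by
    rw [← Real.rpow_add hc0]
    congr 1
    ring
  rw [e1, e2, hsplit]
  generalize mixedEmbedding.norm ((y' 0 : (mixedSpace K)ˣ) : mixedSpace K) ^ (σ - 1) = A
  generalize mixedEmbedding.norm (c : mixedSpace K) ^ (σ - 1) = B
  generalize mixedEmbedding.norm (c : mixedSpace K) ^ (σ + 1) = D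
  ring

variable (K) in
/-- **`∫_{K_∞ˣ} exp(-a‖c‖²) N(c)^r dμ(c) < ∞`** for a Haar measure `μ`, `a > 0`, `r ≥ 2`
(`N^r ≤ N² + N^{M+1}` and the integer moments of `ArchRankinSelbergOfTorusKirillov`).
[cite: CasselsFrohlichANT1967, Ch. XV (Tate), §2.2] -/
theorem lintegral_gauss_mul_norm_rpow_lt_top [MeasurableSpace ((mixedSpace K)ˣ)] [BorelSpace ((mixedSpace K)ˣ)]
    (μc : Measure (mixedSpace K)ˣ) [IsHaarMeasure μc] {a : ℝ} (ha : 0 < a) {r : ℝ} (hr : 2 ≤ r) :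
    ∫⁻ u, ENNReal.ofReal (Real.exp (-(a * ‖(u : mixedSpace K)‖ ^ 2)) *
      mixedEmbedding.norm (u : mixedSpace K) ^ r) ∂μc < ⊤ := by
  obtain ⟨M, hM⟩ : ∃ M : ℕ, r ≤ (M : ℝ) + 1 := ⟨⌈r⌉₊, (Nat.le_ceil r).trans (by linarith)⟩
  have h2 := lintegral_exp_neg_mul_norm_sq_mul_norm_pow_lt_top_of_isHaarMeasure (K := K) ‹_› ‹_› μc ‹_› ha 1
  have hM' := lintegral_exp_neg_mul_norm_sq_mul_norm_pow_lt_top_of_isHaarMeasure (K := K) ‹_› ‹_› μc ‹_› ha M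
  set f1 : (mixedSpace K)ˣ → ℝ≥0∞ := fun u => ENNReal.ofReal (Real.exp (-(a * ‖(u : mixedSpace K)‖ ^ 2)) *
    mixedEmbedding.norm (u : mixedSpace K) ^ (1 + 1)) with hf1
  set f2 : (mixedSpace K)ˣ → ℝ≥0∞ := fun u => ENNReal.ofReal (Real.exp (-(a * ‖(u : mixedSpace K)‖ ^ 2)) *
    mixedEmbedding.norm (u : mixedSpace K) ^ (M + 1)) with hf2
  have hle : ∀ u : (mixedSpace K)ˣ, ENNReal.ofReal (Real.exp (-(a * ‖(u : mixedSpace K)‖ ^ 2)) *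
      mixedEmbedding.norm (u : mixedSpace K) ^ r) ≤ f1 u + f2 u := by
    intro u
    have hN0 := mixedEmbedding.norm_nonneg ((u : (mixedSpace K)ˣ) : mixedSpace K)
    rw [hf1, hf2]
    dsimp only
    rw [← ENNReal.ofReal_add (mul_nonneg (Real.exp_pos _).le (pow_nonneg hN0 _))
      (mul_nonneg (Real.exp_pos _).le (pow_nonneg hN0 _)), ← mul_add]
    refine ENNReal.ofReal_le_ofReal (mul_le_mul_of_nonneg_left ?_ (Real.exp_pos _).le)
    rcases le_total (mixedEmbedding.norm (u : mixedSpace K)) 1 with h | h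
    · calc mixedEmbedding.norm (u : mixedSpace K) ^ r
          ≤ mixedEmbedding.norm (u : mixedSpace K) ^ (((1 + 1 : ℕ)) : ℝ) :=
            Real.rpow_le_rpow_of_exponent_ge (mixedEmbedding_norm_units_pos u) h (by push_cast; linarith)
        _ = mixedEmbedding.norm (u : mixedSpace K) ^ (1 + 1) := Real.rpow_natCast _ _
        _ ≤ _ := le_add_of_nonneg_right (pow_nonneg hN0 _)
    · calc mixedEmbedding.norm (u : mixedSpace K) ^ r
          ≤ mixedEmbedding.norm (u : mixedSpace K) ^ (((M + 1 : ℕ)) : ℝ) :=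
            Real.rpow_le_rpow_of_exponent_le h (by push_cast; linarith)
        _ = mixedEmbedding.norm (u : mixedSpace K) ^ (M + 1) := Real.rpow_natCast _ _
        _ ≤ _ := le_add_of_nonneg_left (pow_nonneg hN0 _)
  have hmeas : Measurable f1 := by
    refine ENNReal.measurable_ofReal.comp (Continuous.measurable ?_)
    exact (Real.continuous_exp.comp (continuous_const.mul (Units.continuous_val.norm.pow 2)).neg).mul
      (((mixedEmbedding.continuous_norm K).comp Units.continuous_val).pow _)
  calc ∫⁻ u, ENNReal.ofReal (Real.exp (-(a * ‖(u : mixedSpace K)‖ ^ 2)) * mixedEmbedding.norm (u : mixedSpace K) ^ r) ∂μc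
      ≤ ∫⁻ u, f1 u + f2 u ∂μc := lintegral_mono hle
    _ = ∫⁻ u, f1 u ∂μc + ∫⁻ u, f2 u ∂μc := lintegral_add_left hmeas _
    _ < ⊤ := ENNReal.add_lt_top.2 ⟨h2, hM'⟩

end Coordinates

/-! ### 7. One representation: `∫ |W_e(diag(y) k)|² |Φ_∞(e₂ diag(y) k)| |det y|^σ δ_B(y)⁻¹ < ∞` -/

section Single

variable {hcpt : isCompact_glFiniteIntegralLevel 2 K}
  {E : Type*} [NormedAddCommGroup E] [InnerProductSpace ℂ E] [CompleteSpace E]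
  {τ : ContRepresentation ℂ (AutomorphyDatum.gl 2 K hcpt).arch.carrier E}
  (hτ : τ.IsStronglyContinuous) {ℓ : archGardingSpace hcpt τ →ₗ[ℂ] ℂ}

set_option maxHeartbeats 4000000 in
/-- **The mirabolic reduction at `re s = σ ≥ 1` with a polynomial-times-Gaussian** (Jacquet–Shalika
(1981), §4; Cogdell (2004), §3.1 (1), §3.2, as in `ArchRankinSelbergOfTorusKirillov`): for `τ`
irreducible unitary on `GL₂(K_∞)`, `ℓ` a continuous Whittaker functional, `e` a `K_∞`-finite Gårding
vector, `Φ_∞` a polynomial times a Gaussian and Haar measures `μA, μK`,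
`∫ |ℓ(τ(diag(y) k) e)|² |Φ_∞(e₂ diag(y) k)| |det y|^σ δ_B(y)⁻¹ d(μA × μK) < ∞`. In the coordinates
`y = c · (u, 1)`: the centre acts by a unitary character, `|Φ_∞| ≤ C e^{-a‖c‖²}` uniformly on `K_∞`,
the weight is `N(c)^{2σ} N(u)^{σ-1}`, the `u`-integral is the weighted Kirillov bound (uniform on the
`K_∞`-orbit) and the `c`-integral a Gaussian moment. [cite: JacquetShalikaAJM1981, §4]
[cite: CogdellAnalyticTheory2004, §3.1 item (1) and §3.2] -/
theorem lintegral_whittaker_sq_polyGaussian_lt_top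
    [MeasurableSpace (GL (Fin 2) (mixedSpace K))] [BorelSpace (GL (Fin 2) (mixedSpace K))]
    [MeasurableSpace ((mixedSpace K)ˣ)] [BorelSpace ((mixedSpace K)ˣ)]
    (hτu : τ.IsUnitary) (hτi : τ.IsTopIrreducible) (hℓ : IsArchContWhittakerFunctional hcpt τ hτ ℓ)
    (e : archGardingSpace hcpt τ)
    (he : FiniteDimensional ℂ (Submodule.span ℂ (Set.range
      fun κ : (AutomorphyDatum.gl 2 K hcpt).arch.maximalCompact => τ (toArch hcpt (κ : GL (Fin 2) (mixedSpace K))) (e : E))))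
    (Φ : (Fin 2 → InfiniteAdeleRing K) → ℂ) (hΦ : IsArchPolyGaussian 2 K Φ) {σ : ℝ} (hσ : 1 ≤ σ)
    (μA : Measure (Fin 2 → (mixedSpace K)ˣ)) [IsHaarMeasure μA] (μK : Measure ↥(Kinf 2 K)) [IsHaarMeasure μK] :
    ∫⁻ p : (Fin 2 → (mixedSpace K)ˣ) × ↥(Kinf 2 K),
      ‖ℓ ⟨τ (toArch hcpt (glDiagonal 2 (mixedSpace K) p.1 * (p.2 : GL (Fin 2) (mixedSpace K)))) (e : E),
          apply_mem_archGardingSpace hτ _ e.2⟩‖ₑ ^ 2 *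
        ENNReal.ofReal (‖Φ (archLastRow 2 K (glDiagonal 2 (mixedSpace K) p.1 * (p.2 : GL (Fin 2) (mixedSpace K))))‖ *
          archTorusWeight 2 K σ p.1) ∂(μA.prod μK) < ⊤ := by
  classical
  haveI : BorelSpace (Fin 1 → (mixedSpace K)ˣ) := Pi.borelSpace
  obtain ⟨ω, hω⟩ := exists_apply_glDiagonal_const_eq_smul (n := 1) (hcpt := hcpt) (τ := τ) hτu hτi
  obtain ⟨C₀, a, hC₀, ha, hgauss⟩ := exists_polyGaussian_archLastRow_le K Φ hΦ
  -- Haar measures on `K_∞ˣ`, `(K_∞ˣ)¹` and the factorisation of `μA`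
  set μc : Measure (mixedSpace K)ˣ := Measure.haar with hμc
  set μA' : Measure (Fin 1 → (mixedSpace K)ˣ) := Measure.haar with hμA'
  obtain ⟨κ, hκ, hμA⟩ := exists_eq_smul_map_snoc_mul (n := 1) (K := K) μA μA' μc
  obtain ⟨B, hB, hKB⟩ := exists_weightedKirillov_orbit_bound hτ hτu hτi hℓ e he (sub_nonneg.2 hσ) μA'
  have hΓ0 := lintegral_gauss_mul_norm_rpow_lt_top K μc ha (r := 2 * σ) (by linarith)
  set Gc : (mixedSpace K)ˣ → ℝ≥0∞ := fun c => ENNReal.ofReal C₀ *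
    ENNReal.ofReal (Real.exp (-(a * ‖(c : mixedSpace K)‖ ^ 2)) * mixedEmbedding.norm (c : mixedSpace K) ^ (2 * σ))
    with hGc
  set Γ : ℝ≥0∞ := ∫⁻ c, Gc c ∂μc with hΓdef
  have hΓ : Γ < ⊤ := by
    simp only [hΓdef, hGc]
    rw [lintegral_const_mul' _ _ ENNReal.ofReal_ne_top]
    exact ENNReal.mul_lt_top ENNReal.ofReal_lt_top hΓ0
  -- the translated vectors and the torus Kirillov integrand
  set v : ↥(Kinf 2 K) → archGardingSpace hcpt τ := fun k =>
    ⟨τ (toArch hcpt (k : GL (Fin 2) (mixedSpace K))) (e : E), apply_mem_archGardingSpace hτ _ e.2⟩ with hv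
  set J : ↥(Kinf 2 K) → (Fin 1 → (mixedSpace K)ˣ) → ℝ≥0∞ := fun k y' =>
    ‖kirillovFn hτ ℓ (v k) (y' 0)‖ₑ ^ 2 *
      ENNReal.ofReal (mixedEmbedding.norm ((y' 0 : (mixedSpace K)ˣ) : mixedSpace K) ^ (σ - 1)) with hJ
  set I : (Fin 2 → (mixedSpace K)ˣ) × ↥(Kinf 2 K) → ℝ≥0∞ := fun p =>
      ‖ℓ ⟨τ (toArch hcpt (glDiagonal 2 (mixedSpace K) p.1 * (p.2 : GL (Fin 2) (mixedSpace K)))) (e : E),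
          apply_mem_archGardingSpace hτ _ e.2⟩‖ₑ ^ 2 *
        ENNReal.ofReal (‖Φ (archLastRow 2 K (glDiagonal 2 (mixedSpace K) p.1 * (p.2 : GL (Fin 2) (mixedSpace K))))‖ *
          archTorusWeight 2 K σ p.1) with hI
  -- pointwise bound in the coordinates `y = c · (u, 1)`
  have hpt : ∀ (k : ↥(Kinf 2 K)) (y' : Fin 1 → (mixedSpace K)ˣ) (c : (mixedSpace K)ˣ),
      I ((fun i => Fin.snoc (α := fun _ => (mixedSpace K)ˣ) y' 1 i * c), k) ≤ J k y' * Gc c := by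
    intro k y' c
    -- the vector: the centre acts by `ω`, the torus through `a(u)`, and `k` on `e`
    have hωc : ∀ x : E, τ (toArch hcpt (glDiagonal 2 (mixedSpace K) fun _ => c)) x = ω c • x := (hω c).2
    have hvec : τ (toArch hcpt (glDiagonal 2 (mixedSpace K)
          (fun i => Fin.snoc (α := fun _ => (mixedSpace K)ˣ) y' 1 i * c) * (k : GL (Fin 2) (mixedSpace K)))) (e : E) =
        ω c • τ (toArch hcpt (diagGL2 (y' 0) 1)) (v k : E) := by
      rw [glDiagonal_snoc_mul, mul_assoc, glDiagonal_const_mul_comm c, glDiagonal_snoc_one_eq_diagGL2]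
      have hmul : toArch hcpt (diagGL2 (y' 0) 1 * ((k : GL (Fin 2) (mixedSpace K)) *
            glDiagonal 2 (mixedSpace K) (fun _ => c))) =
          toArch hcpt (diagGL2 (y' 0) 1) * (toArch hcpt (k : GL (Fin 2) (mixedSpace K)) *
            toArch hcpt (glDiagonal 2 (mixedSpace K) (fun _ => c))) := rfl
      rw [hmul, map_mul, map_mul, ContinuousLinearMap.mul_def, ContinuousLinearMap.mul_def,
        ContinuousLinearMap.comp_apply, ContinuousLinearMap.comp_apply, hωc, map_smul, map_smul]
    have hsub : (⟨τ (toArch hcpt (glDiagonal 2 (mixedSpace K)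
          (fun i => Fin.snoc (α := fun _ => (mixedSpace K)ˣ) y' 1 i * c) * (k : GL (Fin 2) (mixedSpace K)))) (e : E),
          apply_mem_archGardingSpace hτ _ e.2⟩ : archGardingSpace hcpt τ) =
        ω c • ⟨τ (toArch hcpt (diagGL2 (y' 0) 1)) (v k : E), apply_mem_archGardingSpace hτ _ (v k).2⟩ :=
      Subtype.ext hvec
    have hωe : ‖ω c‖ₑ = 1 := by rw [← ofReal_norm, (hω c).1, ENNReal.ofReal_one]
    have hW : ℓ ⟨τ (toArch hcpt (glDiagonal 2 (mixedSpace K)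
          (fun i => Fin.snoc (α := fun _ => (mixedSpace K)ˣ) y' 1 i * c) * (k : GL (Fin 2) (mixedSpace K)))) (e : E),
          apply_mem_archGardingSpace hτ _ e.2⟩ = ω c * kirillovFn hτ ℓ (v k) (y' 0) := by
      rw [hsub, map_smul, smul_eq_mul, kirillovFn_apply]
    -- the test function and the weight
    have hlast : Fin.snoc (α := fun _ => (mixedSpace K)ˣ) y' 1 (Fin.last 1) * c = c := by
      rw [Fin.snoc_last, one_mul]
    have hg := hgauss (k : GL (Fin 2) (mixedSpace K)) k.2 (fun i => Fin.snoc (α := fun _ => (mixedSpace K)ˣ) y' 1 i * c)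
    rw [hlast] at hg
    have hw := archTorusWeight_two_snoc_mul (K := K) σ y' c
    have hN0 : 0 ≤ mixedEmbedding.norm ((y' 0 : (mixedSpace K)ˣ) : mixedSpace K) := mixedEmbedding.norm_nonneg _
    have hNc0 : 0 ≤ mixedEmbedding.norm ((c : (mixedSpace K)ˣ) : mixedSpace K) := mixedEmbedding.norm_nonneg _
    have hreal : ‖Φ (archLastRow 2 K (glDiagonal 2 (mixedSpace K)
          (fun i => Fin.snoc (α := fun _ => (mixedSpace K)ˣ) y' 1 i * c) * (k : GL (Fin 2) (mixedSpace K))))‖ *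
          (mixedEmbedding.norm (c : mixedSpace K) ^ (2 * σ) *
            mixedEmbedding.norm ((y' 0 : (mixedSpace K)ˣ) : mixedSpace K) ^ (σ - 1)) ≤
        mixedEmbedding.norm ((y' 0 : (mixedSpace K)ˣ) : mixedSpace K) ^ (σ - 1) *
          (C₀ * (Real.exp (-(a * ‖(c : mixedSpace K)‖ ^ 2)) * mixedEmbedding.norm (c : mixedSpace K) ^ (2 * σ))) := by
      have hwt0 : 0 ≤ mixedEmbedding.norm (c : mixedSpace K) ^ (2 * σ) *
          mixedEmbedding.norm ((y' 0 : (mixedSpace K)ˣ) : mixedSpace K) ^ (σ - 1) :=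
        mul_nonneg (Real.rpow_nonneg hNc0 _) (Real.rpow_nonneg hN0 _)
      calc _ ≤ (C₀ * Real.exp (-(a * ‖(c : mixedSpace K)‖ ^ 2))) * (mixedEmbedding.norm (c : mixedSpace K) ^ (2 * σ) *
            mixedEmbedding.norm ((y' 0 : (mixedSpace K)ˣ) : mixedSpace K) ^ (σ - 1)) :=
            mul_le_mul_of_nonneg_right hg hwt0
        _ = _ := by ring
    -- assemble
    simp only [hI, hJ, hGc]
    rw [hW, hw, enorm_mul, hωe, one_mul]
    calc _ ≤ ‖kirillovFn hτ ℓ (v k) (y' 0)‖ₑ ^ 2 *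
          ENNReal.ofReal (mixedEmbedding.norm ((y' 0 : (mixedSpace K)ˣ) : mixedSpace K) ^ (σ - 1) *
            (C₀ * (Real.exp (-(a * ‖(c : mixedSpace K)‖ ^ 2)) * mixedEmbedding.norm (c : mixedSpace K) ^ (2 * σ)))) :=
          mul_le_mul' le_rfl (ENNReal.ofReal_le_ofReal hreal)
      _ = _ := by
          rw [ENNReal.ofReal_mul (Real.rpow_nonneg hN0 _), ENNReal.ofReal_mul hC₀]
          ring
  -- finiteness of `J`
  have hJfin : ∀ k y', J k y' ≠ ⊤ := fun k y' =>
    ENNReal.mul_ne_top (ENNReal.pow_ne_top enorm_ne_top) ENNReal.ofReal_ne_top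
  -- the inner integral for fixed `k`
  have hinner : ∀ k : ↥(Kinf 2 K), ∫⁻ y, I (y, k) ∂μA ≤ κ * (B * Γ) := by
    intro k
    rw [hμA, lintegral_smul_measure]
    refine mul_le_mul' le_rfl ?_
    calc ∫⁻ y, I (y, k) ∂((μA'.prod μc).map fun p : (Fin 1 → (mixedSpace K)ˣ) × (mixedSpace K)ˣ =>
            fun i => Fin.snoc (α := fun _ => (mixedSpace K)ˣ) p.1 1 i * p.2)
        ≤ ∫⁻ q, I ((fun i => Fin.snoc (α := fun _ => (mixedSpace K)ˣ) q.1 1 i * q.2), k) ∂(μA'.prod μc) :=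
          lintegral_map_le _ _
      _ ≤ ∫⁻ y', ∫⁻ c, I ((fun i => Fin.snoc (α := fun _ => (mixedSpace K)ˣ) y' 1 i * c), k) ∂μc ∂μA' :=
          lintegral_prod_le _
      _ ≤ ∫⁻ y', ∫⁻ c, J k y' * Gc c ∂μc ∂μA' :=
          lintegral_mono fun y' => lintegral_mono fun c => hpt k y' c
      _ = ∫⁻ y', J k y' * Γ ∂μA' := lintegral_congr fun y' => by rw [lintegral_const_mul' _ _ (hJfin k y')]
      _ = (∫⁻ y', J k y' ∂μA') * Γ := lintegral_mul_const' _ _ hΓ.ne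
      _ ≤ B * Γ := mul_le_mul' (hKB k) le_rfl
  -- integrate over `K_∞`
  haveI : CompactSpace ↥(Kinf 2 K) := isCompact_iff_compactSpace.1 (isCompact_Kinf_holds 2 K)
  haveI : IsFiniteMeasure μK := inferInstance
  change ∫⁻ p, I p ∂(μA.prod μK) < ⊤
  calc ∫⁻ p, I p ∂(μA.prod μK) = ∫⁻ q, I q.swap ∂(μK.prod μA) := (lintegral_prod_swap I).symm
    _ ≤ ∫⁻ k, ∫⁻ y, I (y, k) ∂μA ∂μK := lintegral_prod_le _
    _ ≤ ∫⁻ _k, κ * (B * Γ) ∂μK := lintegral_mono fun k => hinner k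
    _ = κ * (B * Γ) * μK Set.univ := lintegral_const _
    _ < ⊤ := ENNReal.mul_lt_top (ENNReal.mul_lt_top hκ.lt_top (ENNReal.mul_lt_top hB.lt_top hΓ))
        (measure_lt_top _ _)

end Single

end Literature.NumberTheory.Automorphic
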